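import Summits.AtomisticToContinuum.BoseEinsteinCondensation.Theses.BECStronglyRayleigh
import Summits.AtomisticToContinuum.BoseEinsteinCondensation.Theses.BECConjugateDomination
import Summits.AtomisticToContinuum.BoseEinsteinCondensation.Theses.BECWallDressingTransfer
import Summits.AtomisticToContinuum.BoseEinsteinCondensation.Theorems.BECPeriodicReductionBoundaryTransferWeakResidual

/-!
# Crux `BoundaryTransferWeak` (stmt-AtomisticToContinuum-0827) — BIRTH SKELETON, ground-level cut
# (`Lines/birth-groundlevel.lean`; registrar planner-skel-stmt-AtomisticToContinuum-0827-0, instance C, 2026-08-17)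

VARIANT of `Lines/birth.lean` (instance B, line `birth-slackexchange`): same species (the landed transfer
consumes `A`, the residual is cut at the ground level + rigidity), different cut — here the every-slack
statement is MODE-FREE (`maxOccupation`, the weakest statement the conjunct needs) and the mode-free
`√λ_max` Lipschitz transfer it then requires is registered as its own provable stub.

Shared per-potential crux of the torus routes of `AtomisticToContinuum/BoseEinsteinCondensation`
(primary here: `BECStronglyRayleigh`; verbatim the same `def` in `BECConjugateDomination`,
`BECPeriodicReduction`, …): for each repulsive finite-range `v`,

  `A(v)` (torus BEC: at all small `ρ`, `∃ c > 0`, eventually in `N`, `∃ δ > 0`, every periodic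
  `δ`-near-minimiser on the torus of side `L_N = (N/ρ)^{1/3}` has constant-mode occupation `≥ cN`)
  `⟹ ∃ ρ₀ > 0, ∀ ρ ∈ (0, ρ₀), HasGroundStateBEC v ρ` (Dirichlet, mode-free: `λ_max(γ) ≥ c'N` over the
  Dirichlet `δ'`-near-minimisers, `δ'` after `N`).

## What is already landed (used in the composition below, NOT re-registered as stubs)

Everything the hypothesis `A(v)` can be made to say on the Dirichlet side by a state-level map is in
the tree (line `reward-pays-the-wall` of the sister crux `PeriodicToDirichlet` stmt-9483, ported to
0827 in `Theorems/BECPeriodicReductionBoundaryTransferWeakResidual.lean`, p96138):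
`RewardPaysTheWall.stub_transfer` (padded Basti–Cenatiempo–Schlein cut-off of the torus
near-minimisers at the SAME density: `TorusBECAt v ρ c → RewardedUpperBound v ρ (min c 1)`), the
density cap `exists_density_cap_tendsto_e0` (`E₀^D(N,L_N)/N → e₀(ρ) < ∞`), and
`eventually_exists_condensed_of_rewardedUpperBound`; together (`boundaryTransferAt_of_condensedToBECAt`):

  `A(v) ⟹ CC(v, ρ, c)` ("condensed competitors at every macroscopic slack") for `ρ` small,
  `0 < c ≤ 1`:  `∀ θ > 0, ∀ᶠ N, ∃ Ψ : TrialState N (L_N ρ), energy v Ψ ≤ E₀^D + θN ∧ n_flat(Ψ) ≥ (c - θ)N`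
  (flat mode = `boxConstantMode (L_N ρ)`).

Nothing else crosses the wall (Disproof of 9483 §2 δ-erasure, §3/§5 wall `≫ δ`, §4 cat states;
STRATEGY-CENSUS of 9483 (M′)). So this skeleton registers exactly what remains between `CC` and the
mode-free conjunct, cut along the one seam every BEC proof in a cube has — the GROUND-STATE level
versus the NEAR-MINIMISER level — with the ground level said MODE-FREE.

## Registered stubs (signatures spelled in Literature vocabulary only, so that a `--supports` proof
## can restate them verbatim)

* `stub_groundLevelCondensation` — **OPEN, hardest, the research content** (energy → state at the
  ground-state level): `CC(v,ρ,c)` ⟹ `∃ c' > 0`, eventually in `N`, at EVERY slack `ε > 0` some Dirichlet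
  trial state within `ε` of `E₀^D` has `λ_max(γ) ≥ c'N` (`maxOccupation`; the bottom of the Dirichlet
  spectrum is condensed, said without naming a ground state: vanishing-slack competitors are
  `L²`-compact and accumulate only on ground states). For `v ≠ 0` this is BEC of the dilute gas in one
  Dirichlet cube GIVEN condensed competitors at the right energy density; it is NOT the soft
  un-rewarding schema (`Negative/SoftUnrewardingSchema.not_softUnrewarding_twoState`: concavity /
  anchors `∀ λ > 0` cannot give it — a proof must use the Hamiltonian), and being MODE-FREE in its
  conclusion it holds at `v = 0` (`hasGroundStateBEC_zero`: the free Dirichlet ground state `∏ sin`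
  has `λ_max = N` while its flat fraction is only `(8/π²)³`; `Negative/RewardedFreeGasAnchors` kills the
  flat-mode `c' = c` version, not this one). Known first step (provable, deliberately not registered:
  LSSY Ch. 5 (5.15)–(5.17) = `BoseGasFreeDirichletBEC.key_inequality` + `T ≤ energy ≤ E₀^D + ε ≤ C(v,ρ)N`):
  every vanishing-slack competitor is flat at scale `ℓ ≍ ε ξ` (`∑_q ⟨u_q, γ u_q⟩ ≥ (1 - O(ε²))N` over the
  sub-cell constant modes); the open part is COHERENCE from scale `ξ` to scale `L_N` given the condensed
  competitor (STRATEGY-CENSUS 9483 §S-c: for the positive ground state, flat occupation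
  `= N ∫ spread(Y) · localFlatness(Y) dY`, spread = Bhattacharyya affinity of the coarse-grained
  conditional law of a tagged particle with the uniform law — "no localisation of a tagged particle").
  Honours `Cruxes/PeriodicToDirichlet/Disproof.lean` §7: `A` enters only through the state-level
  channel; no energy window on the Dirichlet side (§4), no `λ → 0⁺` endpoint in the statement.
* `stub_rigidity` — **pooled**: verbatim the open item stmt-AtomisticToContinuum-9072,
  `BECWallDressingTransfer.GroundStateRigidity` (difficulty M; `L²`-rigidity of Dirichlet
  near-minimisers up to phase at small density: `E₀ < ∞`, compact resolvent, unique positive ground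
  state, gap at fixed `N`; open for `⊤`-valued `v`, where `HardCoreExtension` stmt-11786 is the fallback).
* `stub_vanishingSlackTransfer` — **provable now, size M** (pure measure theory at fixed `N, L`;
  mode-free analogue of the landed `TorusInTheBox.stub_nearMinimiserTransfer`, p106607, and of the
  flat-mode glue of `Lines/birth.lean`): rigidity at `(v, N, L)` + a `λ_max`-condensed competitor at
  every slack ⟹ `∃ δ > 0`, every `δ`-near-minimiser has `λ_max ≥ (c/4)N`. Mechanism: for each
  normalised mode `φ`, `√occ_φ` is a seminorm with `√occ_φ(Ψ₁ - Ψ₂) ≤ √N ‖φ‖₂ ‖Ψ₁ - Ψ₂‖₂`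
  (Cauchy–Schwarz in `x`, Tonelli in `Y`; landed for one bounded mode as
  `Theorems.SwapToZeroMode.occupation_rpow_half_le_add`) and `occ_φ(aΦ) = occ_φ(Φ)` for `|a| = 1`;
  the supremum over `φ` gives `√λ_max(Ψ) ≥ √λ_max(Φ) - √(Nη)`; take `η = c/16`, `ε = δ`.

## Composition (sorry-free)

`condensedToBECAt_of_sigs : sig₁ → GroundStateRigidity → sig₃ → (∀ v adm, ∃ ρ₄ > 0, ∀ ρ < ρ₄, ∀ c ∈ (0,1],
CC(v,ρ,c) → HasGroundStateBEC v ρ)` is the composition over the three stub SIGNATURES (hypotheses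
spelled out); `BoundaryTransferWeak_of : BECStronglyRayleigh.BoundaryTransferWeak` applies the landed
transfer `boundaryTransferAt_of_condensedToBECAt` to it, instantiated at the three `stub_*` (so its
only non-whitelisted axiom is the stubs' `sorryAx`; the composition itself is closed). Chain:
`A(v)` →(landed transfer, density cap)→ `CC(v, ρ, min c 1)` →(stub 1)→ vanishing-slack
`λ_max`-condensed competitors →(stubs 2, 3)→ `∃ δ > 0`, all `δ`-near-minimisers have `λ_max ≥ (c'/4)N`
→(`le_condensateNumber`)→ `HasGroundStateBEC v ρ`, for `ρ < min(ρ_A, ρ₁, ρ₂, ρ₄, ρ₅)`.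
The verbatim-equal decls of `BECConjugateDomination` and `BECPeriodicReduction` get the same term.

References: LSSY 2005 §1.2 (1.17)–(1.19), Ch. 2 after (2.2)/(2.8), Ch. 5 (5.15)–(5.17), App. D
(D.17); Basti–Cenatiempo–Schlein 2021 App. A; Griffiths 1966 §II; Reed–Simon IV §XIII.12.
-/

noncomputable section

open MeasureTheory Filter
open scoped ENNReal NNReal Topology

namespace Summit.AtomisticToContinuum.BoseEinsteinCondensation.Cruxes.BoundaryTransferWeak.BirthGroundLevel

open Literature.MathematicalPhysics.QuantumManyBody.BoseGas
open Summit.AtomisticToContinuum.BoseEinsteinCondensation.RewardPaysTheWall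
open Summit.AtomisticToContinuum.BoseEinsteinCondensation.Theses

/-! ## Registered stubs -/

/-- **Stub 1 — ground-level condensation from condensed competitors (OPEN; hardest).** For every
repulsive finite-range `v` there is `ρ₄ > 0` such that for `0 < ρ < ρ₄` and `0 < c ≤ 1`: if for every
`θ > 0`, eventually in `N`, some Dirichlet trial state of `Λ_{L_N(ρ)}` lies within `θN` of `E₀^D` with
flat-mode occupation `≥ (c - θ)N`, then for some `c' > 0`, eventually in `N`, at EVERY slack `ε > 0` some
Dirichlet trial state within `ε` of `E₀^D` has `λ_max(γ) ≥ c'N` (mode-free). -/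
theorem stub_groundLevelCondensation :
    ∀ v : ℝ → ℝ≥0∞, IsRepulsiveFiniteRange v → ∃ ρ₄ : ℝ, 0 < ρ₄ ∧ ∀ ρ : ℝ, 0 < ρ → ρ < ρ₄ →
      ∀ c : ℝ, 0 < c → c ≤ 1 →
        (∀ θ : ℝ, 0 < θ → ∀ᶠ N : ℕ in atTop, ∃ Ψ : TrialState N (sideLength ρ N),
          energy v Ψ ≤ groundStateEnergy v N (sideLength ρ N) + ENNReal.ofReal (θ * N) ∧
            ENNReal.ofReal ((c - θ) * N) ≤ occupation N (boxConstantMode (sideLength ρ N)) Ψ.ψ) →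
        ∃ c' : ℝ, 0 < c' ∧ ∀ᶠ N : ℕ in atTop, ∀ ε : ℝ≥0∞, 0 < ε →
          ∃ Φ : TrialState N (sideLength ρ N),
            energy v Φ ≤ groundStateEnergy v N (sideLength ρ N) + ε ∧
              ENNReal.ofReal (c' * N) ≤ maxOccupation N Φ.ψ := by
  sorry

/-- **Stub 2 — rigidity of Dirichlet near-minimisers up to phase (POOLED with the open item
stmt-AtomisticToContinuum-9072, verbatim `BECWallDressingTransfer.GroundStateRigidity`).** -/
theorem stub_rigidity : BECWallDressingTransfer.GroundStateRigidity := by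
  sorry

/-- **Stub 3 — vanishing-slack transfer (provable now, size M).** At fixed `(v, N, L)` and `c > 0`:
rigidity (`∀ η > 0, ∃ δ > 0`, any two `δ`-near-minimisers are `η`-close in `L²` up to a unit constant) +
a `λ_max`-condensed competitor at every slack ⟹ some `δ > 0` makes every `δ`-near-minimiser
`λ_max`-condensed with constant `c/4` (`√λ_max` is a `√N`-Lipschitz, phase-invariant functional of
the wave function in `L²`). -/
theorem stub_vanishingSlackTransfer :
    ∀ (v : ℝ → ℝ≥0∞) (N : ℕ) (L c : ℝ), 0 < c →
      (∀ η : ℝ, 0 < η → ∃ δ : ℝ≥0∞, 0 < δ ∧ ∀ Ψ Φ : TrialState N L,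
        energy v Ψ ≤ groundStateEnergy v N L + δ → energy v Φ ≤ groundStateEnergy v N L + δ →
          ∃ a : ℂ, ‖a‖ = 1 ∧ ∫⁻ X, (‖Ψ.ψ X - a * Φ.ψ X‖₊ : ℝ≥0∞) ^ 2 ≤ ENNReal.ofReal η) →
      (∀ ε : ℝ≥0∞, 0 < ε → ∃ Φ : TrialState N L,
        energy v Φ ≤ groundStateEnergy v N L + ε ∧ ENNReal.ofReal (c * N) ≤ maxOccupation N Φ.ψ) →
      ∃ δ : ℝ≥0∞, 0 < δ ∧ ∀ Ψ : TrialState N L, energy v Ψ ≤ groundStateEnergy v N L + δ →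
        ENNReal.ofReal (c / 4 * N) ≤ maxOccupation N Ψ.ψ := by
  sorry

/-! ## Composition (sorry-free) -/

/-- **The residual of 0827 from the three stub SIGNATURES** (hypotheses spelled out verbatim): for every
admissible `v`, condensed competitors at `(v, ρ, c)` (`ρ` small, `0 < c ≤ 1`) give `HasGroundStateBEC v ρ`
with constant `c'/4`. This is the curried composition; `BoundaryTransferWeak_of` instantiates it at the
registered stubs. [folklore] -/
theorem condensedToBECAt_of_sigs
    (h₁ : ∀ v : ℝ → ℝ≥0∞, IsRepulsiveFiniteRange v → ∃ ρ₄ : ℝ, 0 < ρ₄ ∧ ∀ ρ : ℝ, 0 < ρ → ρ < ρ₄ →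
      ∀ c : ℝ, 0 < c → c ≤ 1 →
        (∀ θ : ℝ, 0 < θ → ∀ᶠ N : ℕ in atTop, ∃ Ψ : TrialState N (sideLength ρ N),
          energy v Ψ ≤ groundStateEnergy v N (sideLength ρ N) + ENNReal.ofReal (θ * N) ∧
            ENNReal.ofReal ((c - θ) * N) ≤ occupation N (boxConstantMode (sideLength ρ N)) Ψ.ψ) →
        ∃ c' : ℝ, 0 < c' ∧ ∀ᶠ N : ℕ in atTop, ∀ ε : ℝ≥0∞, 0 < ε →
          ∃ Φ : TrialState N (sideLength ρ N),
            energy v Φ ≤ groundStateEnergy v N (sideLength ρ N) + ε ∧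
              ENNReal.ofReal (c' * N) ≤ maxOccupation N Φ.ψ)
    (h₂ : BECWallDressingTransfer.GroundStateRigidity)
    (h₃ : ∀ (v : ℝ → ℝ≥0∞) (N : ℕ) (L c : ℝ), 0 < c →
      (∀ η : ℝ, 0 < η → ∃ δ : ℝ≥0∞, 0 < δ ∧ ∀ Ψ Φ : TrialState N L,
        energy v Ψ ≤ groundStateEnergy v N L + δ → energy v Φ ≤ groundStateEnergy v N L + δ →
          ∃ a : ℂ, ‖a‖ = 1 ∧ ∫⁻ X, (‖Ψ.ψ X - a * Φ.ψ X‖₊ : ℝ≥0∞) ^ 2 ≤ ENNReal.ofReal η) →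
      (∀ ε : ℝ≥0∞, 0 < ε → ∃ Φ : TrialState N L,
        energy v Φ ≤ groundStateEnergy v N L + ε ∧ ENNReal.ofReal (c * N) ≤ maxOccupation N Φ.ψ) →
      ∃ δ : ℝ≥0∞, 0 < δ ∧ ∀ Ψ : TrialState N L, energy v Ψ ≤ groundStateEnergy v N L + δ →
        ENNReal.ofReal (c / 4 * N) ≤ maxOccupation N Ψ.ψ) :
    ∀ v : ℝ → ℝ≥0∞, IsRepulsiveFiniteRange v → ∃ ρ₄ : ℝ, 0 < ρ₄ ∧ ∀ ρ : ℝ, 0 < ρ → ρ < ρ₄ →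
      ∀ c : ℝ, 0 < c → c ≤ 1 →
        (∀ θ : ℝ, 0 < θ → ∀ᶠ N : ℕ in atTop, ∃ Ψ : TrialState N (sideLength ρ N),
          energy v Ψ ≤ groundStateEnergy v N (sideLength ρ N) + ENNReal.ofReal (θ * N) ∧
            ENNReal.ofReal ((c - θ) * N) ≤ occupation N (boxConstantMode (sideLength ρ N)) Ψ.ψ) →
        HasGroundStateBEC v ρ := by
  intro v hv
  obtain ⟨ρ₄, hρ₄, H4⟩ := h₁ v hv
  obtain ⟨ρ₅, hρ₅, H5⟩ := h₂ v hv
  refine ⟨min ρ₄ ρ₅, lt_min hρ₄ hρ₅, fun ρ hρ hlt c hc hc1 hCC => ?_⟩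
  obtain ⟨c', hc', hG⟩ := H4 ρ hρ (hlt.trans_le (min_le_left _ _)) c hc hc1 hCC
  have hR := H5 ρ hρ (hlt.trans_le (min_le_right _ _))
  refine ⟨c' / 4, by positivity, ?_⟩
  filter_upwards [hG, hR] with N hGN hRN
  obtain ⟨δ, hδ, hΨ⟩ := h₃ v N (sideLength ρ N) c' hc' hRN hGN
  exact le_condensateNumber v hδ hΨ

/-- **The skeleton theorem: `BoundaryTransferWeak` (stmt-AtomisticToContinuum-0827), route decl of
`BECStronglyRayleigh`, BY NAME, from the registered stubs.** `A(v)` is consumed by the landed transfer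
`boundaryTransferAt_of_condensedToBECAt` (`stub_transfer`, `exists_density_cap_tendsto_e0`,
`eventually_exists_condensed_of_rewardedUpperBound`); the residual by `condensedToBECAt_of_sigs` at the
three stubs. Sorry-free itself; closed the day the three stubs are theorems. [folklore] -/
theorem BoundaryTransferWeak_of : BECStronglyRayleigh.BoundaryTransferWeak :=
  fun v hv hA => boundaryTransferAt_of_condensedToBECAt hv
    (condensedToBECAt_of_sigs stub_groundLevelCondensation stub_rigidity stub_vanishingSlackTransfer v hv)
    hA

/-! ## The same crux under its other route names (verbatim-equal `def`s, same term) -/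

/-- `BECConjugateDomination.BoundaryTransferWeak` (the same item stmt-0827) from the stubs. [folklore] -/
theorem BoundaryTransferWeak_of_conjugateDomination : BECConjugateDomination.BoundaryTransferWeak :=
  fun v hv hA => boundaryTransferAt_of_condensedToBECAt hv
    (condensedToBECAt_of_sigs stub_groundLevelCondensation stub_rigidity stub_vanishingSlackTransfer v hv)
    hA

/-- `BECPeriodicReduction.BoundaryTransferWeak` (home decl of stmt-0827) from the stubs. [folklore] -/
theorem BoundaryTransferWeak_of_periodicReduction : BECPeriodicReduction.BoundaryTransferWeak :=
  boundaryTransferWeak_of_condensedToBEC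
    (condensedToBECAt_of_sigs stub_groundLevelCondensation stub_rigidity stub_vanishingSlackTransfer)

/-- The three route decls are one proposition. [folklore] -/
example : (BECStronglyRayleigh.BoundaryTransferWeak ↔ BECPeriodicReduction.BoundaryTransferWeak) ∧
    (BECConjugateDomination.BoundaryTransferWeak ↔ BECPeriodicReduction.BoundaryTransferWeak) :=
  ⟨Iff.rfl, Iff.rfl⟩

/-! ## Consistency anchor at `v = 0`: the residual the open stub feeds holds outright (landed). -/

example : ∃ ρ₄ : ℝ, 0 < ρ₄ ∧ ∀ ρ : ℝ, 0 < ρ → ρ < ρ₄ → ∀ c : ℝ, 0 < c → c ≤ 1 →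
    (∀ θ : ℝ, 0 < θ → ∀ᶠ N : ℕ in atTop, ∃ Ψ : TrialState N (sideLength ρ N),
      energy 0 Ψ ≤ groundStateEnergy 0 N (sideLength ρ N) + ENNReal.ofReal (θ * N) ∧
        ENNReal.ofReal ((c - θ) * N) ≤ occupation N (boxConstantMode (sideLength ρ N)) Ψ.ψ) →
    HasGroundStateBEC 0 ρ :=
  ⟨1, one_pos, fun _ hρ _ _ _ _ _ => hasGroundStateBEC_zero hρ⟩

end Summit.AtomisticToContinuum.BoseEinsteinCondensation.Cruxes.BoundaryTransferWeak.BirthGroundLevel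

end
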